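import Summits.ResolutionOfSingularities.ResolutionOfSingularities.Theorems.FrobeniusLadderFInjectiveMacaulayficationFHalfRowOfProductCentre
import HarnessLib

/-!
# «CURE BY DOMINATION» AS ONE APPLICATION: a floor `I` is CURED as soon as the blowing up along the triple product `I·L·J` is FULL — `L` the (landed) class centre, `J` any
# `𝔪`-primary dominating factor (Q17 arm B's (2a), kernel form)
# (crux `FInjectiveMacaulayfication` stmt-ResolutionOfSingularities-15315, chain w45a; res-L1-w45a-plan-1 RULING R22.22 (3) «stub-1 g14 ON-CALL ITEM (after (β″), before the registrar; S):
# ★ `floorCured_of_fullBlowup_classModel` = (2a) in the kernel: for a bed with a landed class cure L (Bl_L X FULL/regular), an arbitrary 𝔪-supported centre I and an 𝔪-primary J: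
# (∀ s, FullCl p (stalk of Bl_{I·L·J} X)) → (floor I CURED in the stub letter) via ✓p618085 + the product identity (… state the hypothesis directly on Bl_{I·L·J} X and leave the
# iterated-blow-up identification to the data side)»; seat res-L1-w45a-stub-1 g14)

[OURS · L1 W4.5a] Support file (`--supports stmt-ResolutionOfSingularities-15315 --as helper`); def-free; UNCONDITIONAL; no named fact; NOT a statement of any manuscript. Glue only —
the FULLness of `Bl_{I·L·J} X` is the hypothesis each arm-B specimen discharges by data; the identification `Bl_{I·L·J} X ≅ Bl_{(I·J)𝒪_{X̃}} X̃` (`X̃ = Bl_L X`) is NOT used or proved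
here (data side). Nothing of the crux is proved. AI-written (AI review is weaker than expert review).

* §1 (affine, any domain `A`) ★ `floorCured_of_fullBlowup_classModel` — `I, L, J ≠ ⊥` ideals of `A`, `v ∈ Spec A` with `v ⊆ √L` and `v ⊆ √J` (both factors supported at `v`), and
  `Bl_{I·(L·J)}(Spec A) = affineBlowup (I * (L * J))` FULL at every point ⇒ for EVERY blowing up `S′ → Spec 𝒪_{Spec A,v}` along `Ĩ·𝒪_v` there is `𝓚 ≠ ⊥` on `S′`, supported over the closed
  point, all of whose blowings up are FULL (`𝓚 =` the pull-back of `(L·J)~`). One application of ✓ `FHalfRowOfProductCentre.fHalfConclusion_of_affineBlowup_mul` with `K := L·J`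
  (`√(L·J) = √L ⊓ √J`). `floorCured_of_fullBlowup_classModel'` — the same with the product written `I * L * J`.
* §2 (scheme level) `floorCured_of_isBlowup_classModel` — `X` integral, `x ∈ X`, ideal sheaves `Jτ` (floor), `JL`, `JJ` with supports over `x`, a model `π₂ : X₂ → X` that is a
  blowing up along `Jτ·(JL·JJ)`, FULL at the points over generizations of `x` ⇒ the same conclusion (✓ `fHalfConclusion_of_isBlowup_mul`).
* §3 (hypersurface letter) `floorCured_of_fullBlowup_classModel_hypersurface` — `A = k[X]/(f)`, `v` the origin, `L = (x̄^KL)` and `J = (x̄^KJ)`-or-any ideal containing a power of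
  every variable: the hypotheses `v ⊆ √L`, `v ⊆ √J` discharged from «a pure power of every variable lies in `L`, `J`».
[folklore assembly; cite: StacksProject, Tag 080A; GortzWedhorn2020, Prop. 13.91 (2)]
-/

-- single-problem summit: the doubled namespace component is forced
set_option linter.dupNamespace false

noncomputable section

namespace Summit.ResolutionOfSingularities.ResolutionOfSingularities.Theorems.FInjectiveMacaulayfication.FloorCuredOfClassModel

open CategoryTheory CategoryTheory.Limits AlgebraicGeometry TopologicalSpace IsLocalRing MvPolynomial
open Literature.AlgebraicGeometry.Resolution
open Summit.ResolutionOfSingularities.ResolutionOfSingularities.Theorems.FInjectiveMacaulayfication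
open SliceableCentre GermOfGlobalBlowup

/-! ## §1 Affine form -/

/-- ★ **CURE BY DOMINATION, ONE APPLICATION.** `A` a domain, `I, L, J ≠ ⊥` ideals, `v ∈ Spec A` with `v ⊆ √L` and `v ⊆ √J`; if the affine blow-up `Bl_{I·(L·J)}(Spec A)` is FULL
(`FullCl p`) at every point, then for EVERY blowing up `g : S′ → Spec 𝒪_{Spec A, v}` along `Ĩ·𝒪_v` there is an ideal sheaf `𝓚 ≠ ⊥` on `S′`, supported over the closed point, ALL of
whose blowings up are FULL at every stalk — the floor `I` is CURED. [folklore assembly; cite: StacksProject, Tag 080A; GortzWedhorn2020, Prop. 13.91 (2)] -/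
theorem floorCured_of_fullBlowup_classModel (p : ℕ) {A : Type} [CommRing A] [IsDomain A] (I L J : Ideal A) (hI : I ≠ ⊥) (hL : L ≠ ⊥) (hJ : J ≠ ⊥)
    (v : Spec (.of A)) (hvL : v.asIdeal ≤ L.radical) (hvJ : v.asIdeal ≤ J.radical)
    (hrow : ∀ y : ↥(affineBlowup (I * (L * J))), FullCl p ((affineBlowup (I * (L * J))).presheaf.stalk y)) :
    ∀ (S' : Scheme.{0}) (g : S' ⟶ Spec ((Spec (.of A)).presheaf.stalk v)),
      IsBlowup g ((affineBlowup.idealSheaf I).comap ((Spec (.of A)).fromSpecStalk v)) →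
      ∃ 𝓚 : S'.IdealSheafData, 𝓚 ≠ ⊥ ∧ (∀ s ∈ (𝓚.support : Set S'), g.base s = closedPoint ((Spec (.of A)).presheaf.stalk v)) ∧
        ∀ (S'' : Scheme.{0}) (π : S'' ⟶ S'), IsBlowup π 𝓚 → ∀ s : S'', FullCl p (S''.presheaf.stalk s) := by
  have hK : L * J ≠ ⊥ := mul_ne_zero hL hJ
  have hvK : v.asIdeal ≤ (L * J).radical := by
    rw [Ideal.radical_mul]
    exact le_inf hvL hvJ
  exact FHalfRowOfProductCentre.fHalfConclusion_of_affineBlowup_mul p I (L * J) hI hK v hvK hrow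

/-- The same with the centre written `I * L * J`. [plumbing] -/
theorem floorCured_of_fullBlowup_classModel' (p : ℕ) {A : Type} [CommRing A] [IsDomain A] (I L J : Ideal A) (hI : I ≠ ⊥) (hL : L ≠ ⊥) (hJ : J ≠ ⊥)
    (v : Spec (.of A)) (hvL : v.asIdeal ≤ L.radical) (hvJ : v.asIdeal ≤ J.radical)
    (hrow : ∀ y : ↥(affineBlowup (I * L * J)), FullCl p ((affineBlowup (I * L * J)).presheaf.stalk y)) :
    ∀ (S' : Scheme.{0}) (g : S' ⟶ Spec ((Spec (.of A)).presheaf.stalk v)),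
      IsBlowup g ((affineBlowup.idealSheaf I).comap ((Spec (.of A)).fromSpecStalk v)) →
      ∃ 𝓚 : S'.IdealSheafData, 𝓚 ≠ ⊥ ∧ (∀ s ∈ (𝓚.support : Set S'), g.base s = closedPoint ((Spec (.of A)).presheaf.stalk v)) ∧
        ∀ (S'' : Scheme.{0}) (π : S'' ⟶ S'), IsBlowup π 𝓚 → ∀ s : S'', FullCl p (S''.presheaf.stalk s) := by
  rw [mul_assoc] at hrow
  exact floorCured_of_fullBlowup_classModel p I L J hI hL hJ v hvL hvJ hrow

/-! ## §2 Scheme-level form -/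

/-- **CURE BY DOMINATION, scheme level.** `X` integral, `x ∈ X`, ideal sheaves `Jτ` (the floor), `JL` (class centre), `JJ` (dominating factor) with `Jτ·(JL·JJ) ≠ ⊥` and the supports
of `JL`, `JJ` over `x` among the generizations of `x`; a model `π₂ : X₂ → X` that IS a blowing up along `Jτ·(JL·JJ)` and is FULL at every point over a generization of `x` ⇒ the floor
`Jτ` is CURED at `x`. [folklore assembly; cite: StacksProject, Tag 080A] -/
theorem floorCured_of_isBlowup_classModel (p : ℕ) {X X₂ : Scheme.{0}} [IsIntegral X] (x : X) {π₂ : X₂ ⟶ X} {Jτ JL JJ : X.IdealSheafData}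
    (hπ₂ : IsBlowup π₂ (Jτ * (JL * JJ))) (hne : Jτ * (JL * JJ) ≠ ⊥)
    (hsuppL : ∀ y ∈ (JL.support : Set X), y ⤳ x → y = x) (hsuppJ : ∀ y ∈ (JJ.support : Set X), y ⤳ x → y = x)
    (hfull : ∀ x₂ : X₂, π₂.base x₂ ⤳ x → FullCl p (X₂.presheaf.stalk x₂)) :
    ∀ (S' : Scheme.{0}) (g : S' ⟶ Spec (X.presheaf.stalk x)), IsBlowup g (Jτ.comap (X.fromSpecStalk x)) →
      ∃ 𝓚 : S'.IdealSheafData, 𝓚 ≠ ⊥ ∧ (∀ s ∈ (𝓚.support : Set S'), g.base s = closedPoint (X.presheaf.stalk x)) ∧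
        ∀ (S'' : Scheme.{0}) (π : S'' ⟶ S'), IsBlowup π 𝓚 → ∀ s : S'', FullCl p (S''.presheaf.stalk s) := by
  refine FHalfRowOfProductCentre.fHalfConclusion_of_isBlowup_mul p x hπ₂ hne (fun y hy hyx => ?_) hfull
  -- `Supp (JL·JJ) ⊆ Supp JL ∪ Supp JJ`
  rw [Scheme.IdealSheafData.support_mul] at hy
  rcases hy with hy | hy
  · exact hsuppL y hy hyx
  · exact hsuppJ y hy hyx

/-! ## §3 The hypersurface letter -/

/-- **CURE BY DOMINATION in the hypersurface letter.** `X = Spec k[X₀..X_{n−1}]/(f)` a domain (`(f)` prime), `v` the origin; the floor `I`, the class centre `L` and the dominating factor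
`J` are ideals of `k[X]/(f)`, all `≠ ⊥`, with a pure power of every variable in `L` and in `J`; if `affineBlowup (I * (L * J))` is FULL at every point, the floor `I` is CURED at `v`.
[folklore assembly; cite: StacksProject, Tag 080A] -/
theorem floorCured_of_fullBlowup_classModel_hypersurface (p : ℕ) (k : Type) [Field k] {n : ℕ} (f : MvPolynomial (Fin n) k) (hfprime : (Ideal.span {f}).IsPrime)
    (I L J : Ideal (MvPolynomial (Fin n) k ⧸ Ideal.span {f})) (hI : I ≠ ⊥) (hL : L ≠ ⊥) (hJ : J ≠ ⊥)
    (hLpow : ∀ j : Fin n, ∃ N : ℕ, Ideal.Quotient.mk (Ideal.span {f}) (X j) ^ N ∈ L)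
    (hJpow : ∀ j : Fin n, ∃ N : ℕ, Ideal.Quotient.mk (Ideal.span {f}) (X j) ^ N ∈ J)
    (hrow : ∀ y : ↥(affineBlowup (I * (L * J))), FullCl p ((affineBlowup (I * (L * J))).presheaf.stalk y))
    (v : Spec (.of (MvPolynomial (Fin n) k ⧸ Ideal.span {f})))
    (hv : v.asIdeal = Ideal.span (Set.range fun j : Fin n => Ideal.Quotient.mk (Ideal.span {f}) (X j))) :
    ∀ (S' : Scheme.{0}) (g : S' ⟶ Spec ((Spec (.of (MvPolynomial (Fin n) k ⧸ Ideal.span {f}))).presheaf.stalk v)),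
      IsBlowup g ((affineBlowup.idealSheaf I).comap ((Spec (.of (MvPolynomial (Fin n) k ⧸ Ideal.span {f}))).fromSpecStalk v)) →
      ∃ 𝓚 : S'.IdealSheafData, 𝓚 ≠ ⊥ ∧ (∀ s ∈ (𝓚.support : Set S'), g.base s = closedPoint _) ∧
        ∀ (S'' : Scheme.{0}) (π : S'' ⟶ S'), IsBlowup π 𝓚 → ∀ s : S'', FullCl p (S''.presheaf.stalk s) := by
  haveI := hfprime
  haveI : IsDomain (MvPolynomial (Fin n) k ⧸ Ideal.span {f}) := Ideal.Quotient.isDomain _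
  have hrad : ∀ M : Ideal (MvPolynomial (Fin n) k ⧸ Ideal.span {f}), (∀ j : Fin n, ∃ N : ℕ, Ideal.Quotient.mk (Ideal.span {f}) (X j) ^ N ∈ M) → v.asIdeal ≤ M.radical := by
    intro M hM
    rw [hv, Ideal.span_le]
    rintro _ ⟨j, rfl⟩
    obtain ⟨N, hN⟩ := hM j
    exact ⟨N, hN⟩
  exact floorCured_of_fullBlowup_classModel p I L J hI hL hJ v (hrad L hLpow) (hrad J hJpow) hrow

end Summit.ResolutionOfSingularities.ResolutionOfSingularities.Theorems.FInjectiveMacaulayfication.FloorCuredOfClassModel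

end
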